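import Literature.Probability.LatticeModels.TorusBlockKernelInfraredFloor
import HarnessLib

/-!
# Block kernels of positive-semidefinite kernels are asymptotically flat (two-sided bound)

Sequel of `TorusBlockKernelFloor.lean` / `TorusBlockKernelRemainder.lean` /
`TorusBlockKernelInfraredFloor.lean`. For a symmetric translation-invariant kernel `K` on `(ℤ/Mℤ)^d`,
`M = b·m`, with nonnegative real quadratic form, block kernel `K_b`, `Λ = Σ_{x,y} K` and incoherent
remainder `R_b = M^{-d} Σ_{k ≠ 0} Re κ̂(k)|1̂_B(k)|²` (`κ = K(0,·)`):

* `TorusBlock.blockKernel_le_diag` — `K_b(x,y) ≤ K_b(0,0)` (test the quadratic form on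
  `1_{block x} - 1_{block y}`; the diagonal block sums are all `K_b(0,0)`);
* `TorusBlock.blockKernel_le_coherent_add_remainder` — hence `K_b(x,y) ≤ b^{2d}Λ/M^{2d} + R_b`, the
  upper companion of the floor `K_b(x,y) ≥ b^{2d}Λ/M^{2d} - R_b` (`blockKernel_floor_remainder`):
  `|K_b(x,y) - b^{2d}Λ/M^{2d}| ≤ R_b` for ALL `x, y`;
* `d = 2`, infrared bound `Re κ̂(k) ≤ B/√ε(k)` (`k ≠ 0`): `|K_b(x,y) - b⁴Λ/M⁴| ≤ 18 B b³`
  (`TorusBlock.abs_blockKernel_sub_coherent_le`, coarse form `abs_coarseKernel_sub_coherent_le`).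
  With Cesàro long-range order `Λ ≥ a M⁴` every block entry is within the factor
  `(ab + 18B)/(ab - 18B)` of the coherent value `b⁴Λ/M⁴`: block two-point functions of an ordered
  state obeying an infrared bound are asymptotically CONSTANT in the block variable (relative spread
  `O(B/(a b))`), and the Lévy mass `mean_X log(k_b(0)/k_b(X))` of the block kernel is `O(B/(ab))`.

Sources: as in the previous files (S. Friedli, Y. Velenik (2017) §10.4; J. Fröhlich, B. Simon,
T. Spencer (1976) §3; T. Kennedy, E. H. Lieb, B. S. Shastry (1988)); elementary (folklore).
No definition is introduced.
-/

noncomputable section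

open Finset Complex
open scoped BigOperators ComplexConjugate Real

namespace Literature.Probability.LatticeModels

namespace TorusBlock

variable {d b m M : ℕ} [NeZero M] [NeZero m]

/-- **Off-diagonal block sums are at most the diagonal one**: `K_b(x,y) ≤ K_b(0,0)` for a symmetric,
translation-invariant kernel with nonnegative quadratic form (test on `1_{block x} - 1_{block y}`:
`0 ≤ K_b(x,x) + K_b(y,y) - 2K_b(x,y)`, and `K_b(x,x) = K_b(y,y) = K_b(0,0)`). [folklore] -/
theorem blockKernel_le_diag (hM : M = b * m) (K : TorusSite d M → TorusSite d M → ℝ)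
    (hT : ∀ v x y : TorusSite d M, K (x + v) (y + v) = K x y) (hS : ∀ x y : TorusSite d M, K x y = K y x)
    (hP : ∀ c : TorusSite d M → ℝ, 0 ≤ ∑ x, ∑ y, c x * c y * K x y) (x y : TorusSite d M) :
    (∑ x' : TorusSite d M, ∑ y' : TorusSite d M,
        if (∀ i : Fin d, (x' i).val / b = (x i).val / b) ∧ (∀ i : Fin d, (y' i).val / b = (y i).val / b)
        then K x' y' else 0) ≤
      ∑ x' : TorusSite d M, ∑ y' : TorusSite d M,
        if (∀ i : Fin d, (x' i).val / b = ((0 : TorusSite d M) i).val / b) ∧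
            (∀ i : Fin d, (y' i).val / b = ((0 : TorusSite d M) i).val / b)
        then K x' y' else 0 := by
  classical
  set u : TorusSite d M → ℝ := fun x' => if ∀ i : Fin d, (x' i).val / b = (x i).val / b then 1 else 0
    with hu
  set v : TorusSite d M → ℝ := fun y' => if ∀ i : Fin d, (y' i).val / b = (y i).val / b then 1 else 0
    with hv
  have key := hP fun z => u z - v z
  have hexp : ∀ x' y', (u x' - v x') * (u y' - v y') * K x' y' =
      u x' * u y' * K x' y' + v x' * v y' * K x' y' - (u x' * v y' * K x' y' + v x' * u y' * K x' y') := by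
    intro x' y'; ring
  simp_rw [hexp, Finset.sum_sub_distrib, Finset.sum_add_distrib] at key
  -- identify the four double sums
  have hsym : ∑ x', ∑ y', v x' * u y' * K x' y' = ∑ x', ∑ y', u x' * v y' * K x' y' := by
    rw [Finset.sum_comm]
    refine Finset.sum_congr rfl fun x' _ => Finset.sum_congr rfl fun y' _ => ?_
    rw [hS y' x']; ring
  have huv : ∑ x', ∑ y', u x' * v y' * K x' y' = ∑ x' : TorusSite d M, ∑ y' : TorusSite d M,
      if (∀ i : Fin d, (x' i).val / b = (x i).val / b) ∧ (∀ i : Fin d, (y' i).val / b = (y i).val / b)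
      then K x' y' else 0 :=
    Finset.sum_congr rfl fun x' _ => Finset.sum_congr rfl fun y' _ => blockIndicator_mul K x y x' y'
  have huu : ∑ x', ∑ y', u x' * u y' * K x' y' = ∑ x' : TorusSite d M, ∑ y' : TorusSite d M,
      if (∀ i : Fin d, (x' i).val / b = ((0 : TorusSite d M) i).val / b) ∧
          (∀ i : Fin d, (y' i).val / b = ((0 : TorusSite d M) i).val / b)
      then K x' y' else 0 := by
    rw [← blockKernel_diag_eq hM K hT x]
    exact Finset.sum_congr rfl fun x' _ => Finset.sum_congr rfl fun y' _ =>
      blockIndicator_mul K x x x' y'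
  have hvv : ∑ x', ∑ y', v x' * v y' * K x' y' = ∑ x' : TorusSite d M, ∑ y' : TorusSite d M,
      if (∀ i : Fin d, (x' i).val / b = ((0 : TorusSite d M) i).val / b) ∧
          (∀ i : Fin d, (y' i).val / b = ((0 : TorusSite d M) i).val / b)
      then K x' y' else 0 := by
    rw [← blockKernel_diag_eq hM K hT y]
    exact Finset.sum_congr rfl fun x' _ => Finset.sum_congr rfl fun y' _ =>
      blockIndicator_mul K y y x' y'
  rw [hsym, huv, huu, hvv] at key
  linarith

/-- **Two-sided closeness to the coherent term** (any `d`): together with the floor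
`K_b(x,y) ≥ b^{2d}Λ/M^{2d} - R_b` one has `K_b(x,y) ≤ K_b(0,0) = b^{2d}Λ/M^{2d} + R_b`, so
`|K_b(x,y) - b^{2d}Λ/M^{2d}| ≤ R_b = M^{-d} Σ_{k ≠ 0} Re κ̂(k)|1̂_B(k)|²`. [folklore] -/
theorem blockKernel_le_coherent_add_remainder (hM : M = b * m) (K : TorusSite d M → TorusSite d M → ℝ)
    (hT : ∀ v x y : TorusSite d M, K (x + v) (y + v) = K x y) (hS : ∀ x y : TorusSite d M, K x y = K y x)
    (hP : ∀ c : TorusSite d M → ℝ, 0 ≤ ∑ x, ∑ y, c x * c y * K x y) (x y : TorusSite d M) :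
    (∑ x' : TorusSite d M, ∑ y' : TorusSite d M,
        if (∀ i : Fin d, (x' i).val / b = (x i).val / b) ∧ (∀ i : Fin d, (y' i).val / b = (y i).val / b)
        then K x' y' else 0) ≤
      ((b : ℝ) ^ d) ^ 2 * (∑ x' : TorusSite d M, ∑ y' : TorusSite d M, K x' y') / ((M : ℝ) ^ d) ^ 2 +
        (((M : ℝ) ^ d)⁻¹) * ∑ k ∈ Finset.univ.erase (0 : TorusSite d M),
          (torusFourier (fun z => (K 0 z : ℂ)) k).re *
          ‖torusFourier (fun x : TorusSite d M =>
            ((if ∀ i : Fin d, (x i).val / b = ((0 : TorusSite d M) i).val / b then (1 : ℝ) else 0 : ℝ) : ℂ))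
            k‖ ^ 2 := by
  rw [← blockKernel_zero_eq_coherent_add hM K hT hS]
  exact blockKernel_le_diag hM K hT hS hP x y

section TwoDim

variable {b m M : ℕ} [NeZero M] [NeZero m]

/-- **Asymptotic flatness of block kernels, `d = 2`**: under the infrared bound
`Re κ̂(k) ≤ B/√ε(k)` (`k ≠ 0`, `B ≥ 0`), `|K_b(x,y) - b⁴Λ/M⁴| ≤ 18 B b³` for all `x, y`, uniformly in
`M ∈ bℕ`. [folklore] -/
theorem abs_blockKernel_sub_coherent_le (hM : M = b * m)
    (K : TorusSite 2 M → TorusSite 2 M → ℝ)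
    (hT : ∀ v x y : TorusSite 2 M, K (x + v) (y + v) = K x y) (hS : ∀ x y : TorusSite 2 M, K x y = K y x)
    (hP : ∀ c : TorusSite 2 M → ℝ, 0 ≤ ∑ x, ∑ y, c x * c y * K x y) (B : ℝ) (hB : 0 ≤ B)
    (hIR : ∀ k : TorusSite 2 M, k ≠ 0 →
      (torusFourier (fun z => (K 0 z : ℂ)) k).re ≤ B / Real.sqrt (dispersion (latticeMomentum M k)))
    (x y : TorusSite 2 M) :
    |(∑ x' : TorusSite 2 M, ∑ y' : TorusSite 2 M,
        if (∀ i : Fin 2, (x' i).val / b = (x i).val / b) ∧ (∀ i : Fin 2, (y' i).val / b = (y i).val / b)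
        then K x' y' else 0) -
      (b : ℝ) ^ 4 * (∑ x' : TorusSite 2 M, ∑ y' : TorusSite 2 M, K x' y') / (M : ℝ) ^ 4| ≤
      18 * B * (b : ℝ) ^ 3 := by
  have hlow := blockKernel_floor_of_infraredBound hM K hT hS hP B hB hIR x y
  have hup := blockKernel_le_coherent_add_remainder (d := 2) hM K hT hS hP x y
  have hrem := remainder_le_of_infraredBound hM (fun k => (torusFourier (fun z => (K 0 z : ℂ)) k).re)
    B hB hIR
  have h3 : ((b : ℝ) ^ 2) ^ 2 * (∑ x' : TorusSite 2 M, ∑ y' : TorusSite 2 M, K x' y') /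
      ((M : ℝ) ^ 2) ^ 2 = (b : ℝ) ^ 4 * (∑ x' : TorusSite 2 M, ∑ y' : TorusSite 2 M, K x' y') /
      (M : ℝ) ^ 4 := by ring
  rw [h3] at hup
  rw [abs_le]
  constructor <;> linarith

/-- Coarse form of `abs_blockKernel_sub_coherent_le`: `|k_b(X) - b⁴Λ/M⁴| ≤ 18 B b³` for every coarse
site `X`. [folklore] -/
theorem abs_coarseKernel_sub_coherent_le (hM : M = b * m)
    (K : TorusSite 2 M → TorusSite 2 M → ℝ)
    (hT : ∀ v x y : TorusSite 2 M, K (x + v) (y + v) = K x y) (hS : ∀ x y : TorusSite 2 M, K x y = K y x)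
    (hP : ∀ c : TorusSite 2 M → ℝ, 0 ≤ ∑ x, ∑ y, c x * c y * K x y) (B : ℝ) (hB : 0 ≤ B)
    (hIR : ∀ k : TorusSite 2 M, k ≠ 0 →
      (torusFourier (fun z => (K 0 z : ℂ)) k).re ≤ B / Real.sqrt (dispersion (latticeMomentum M k)))
    (X : TorusSite 2 m) :
    |(∑ x' : TorusSite 2 M, ∑ y' : TorusSite 2 M,
        if (∀ i : Fin 2, (x' i).val / b = (X i).val) ∧ (∀ i : Fin 2, (y' i).val / b = 0)
        then K x' y' else 0) -
      (b : ℝ) ^ 4 * (∑ x' : TorusSite 2 M, ∑ y' : TorusSite 2 M, K x' y') / (M : ℝ) ^ 4| ≤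
      18 * B * (b : ℝ) ^ 3 := by
  classical
  set s : TorusSite 2 M := fun j => ((b * (X j).val : ℕ) : ZMod M) with hs
  have key := abs_blockKernel_sub_coherent_le hM K hT hS hP B hB hIR s 0
  rw [blockKernel_zero_eq_coarse hM K hT s] at key
  have hβs : (fun i : Fin 2 => (((s i).val / b : ℕ) : ZMod m)) = X := coarse_lift hM X
  have h1 : ∀ i : Fin 2, ((((s i).val / b : ℕ) : ZMod m)).val = (X i).val := fun i => by
    rw [congrFun hβs i]
  simp only [h1] at key
  exact key

end TwoDim

end TorusBlock

end Literature.Probability.LatticeModels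

end
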